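import Summits.AtomisticToContinuum.Crystallization.Theses.ExcessDecayLiouville
import Summits.AtomisticToContinuum.Crystallization.Theses.HcpDefectCounting
import Summits.AtomisticToContinuum.Crystallization.Theorems.ExcessDecayLiouvilleCoarseGrainsTrialBound
import Summits.AtomisticToContinuum.Crystallization.Theorems.ExcessDecayLiouvilleCoarseGrainsCompactness
import Summits.AtomisticToContinuum.Crystallization.Theorems.ExcessDecayLiouvilleCoarseGrainsIsoDictionary
import Summits.AtomisticToContinuum.Crystallization.Theorems.ExcessDecayLiouvilleCoarseGrainsHcpEnergySeries
import Summits.AtomisticToContinuum.Crystallization.Theorems.ExcessDecayLiouvilleCoarseGrainsKeyRigidity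
import Summits.AtomisticToContinuum.Crystallization.Theorems.ExcessDecayLiouvilleCoarseGrainsExactLocalRules
import Summits.AtomisticToContinuum.Crystallization.Theorems.ExcessDecayLiouvilleCoarseGrainsPinFromSeries
import Summits.AtomisticToContinuum.Crystallization.Theorems.ExcessDecayLiouvilleCoarseGrainsPinNumerics
import Literature.MathematicalPhysics.StatisticalMechanics.LennardJonesClusters
import Literature.MathematicalPhysics.StatisticalMechanics.BarlowStacking

/-!
# Crux `CoarseGrains` (stmt-AtomisticToContinuum-9331), line `vanishing-excess-truss-rigidity`: the assembled reduction

`CoarseGrains_of : HcpDefectCounting.HcpBulkFloor → HcpDefectCounting.HcpDefectCoercivity →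
ExcessDecayLiouville.CoarseGrains` — the crux of route `ExcessDecayLiouville` REDUCED, sorry-free, to the
two sibling cruxes of route `HcpDefectCounting` (stmt-14477 the finite bulk floor at relaxed hcp, stmt-14476
defect-counting coercivity at radius 4), which enter BY NAME (a CONDITIONAL result: the crux item closes when
those items close).  All seven registered stubs of the line skeleton are landed theorems of this directory:
`stub_trialBound` (…TrialBound), `stub_hcpEnergySeries` (…HcpEnergySeries), `stub_pinNumerics`
(…PinNumerics, certified lattice sums), `stub_pinFromSeries` (…PinFromSeries), `stub_keyRigidity`
(…KeyRigidity), `stub_exactLocalRules` (…ExactLocalRules), `stub_compactness` (…Compactness),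
`stub_isoDictionary` (…IsoDictionary).  This file supplies the glue: the admissible-window pin `windowPin`
(hcp energy series + Fermat/dilation reduction + certified numerics), truss propagation `trussPropagation`
(key rigidity + exact local rules + compactness), clean-ball selection by double counting
(`exists_clean_ball`), the floor/trial-bound comparison (`energyPerParticle_le_of_floor`) and the
composition.  Mechanism: floor (14477) ⇒ hcp(a,h) minimal among hcp(a',h') ⇒ (a,h) in the admissible
window; coercivity (14476) at the θ(δ,R,1/40) of truss propagation and the trial bound at
η = κ/(2(2R'/δ+1)³) give (2R'/δ+1)³·#Bad(4,θ) < N in every large ground state, hence a particle with no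
Bad particle within R', hence a radius-R chart at tolerance 1/40, hence the crux datum.
-/

noncomputable section

namespace Summit.AtomisticToContinuum.Crystallization.Theorems.ExcessDecayLiouvilleCoarseGrains

open Literature.MathematicalPhysics.StatisticalMechanics
open Summit.AtomisticToContinuum.Crystallization.Theses

/-! ## Glue: the window pin and truss propagation from the landed stubs -/

/-- **The admissible-window pin**: a box point whose hcp energy is minimal among all `hcp(a',h')` lies in the
admissible window (`stub_pinFromSeries` fed with `stub_hcpEnergySeries` and the certified `stub_pinNumerics`). [folklore] -/
theorem windowPin :
    ∀ (a h : ℝ) (ha : a ≠ 0) (hh : h ≠ 0), 47 / 50 ≤ a → a ≤ 1 → 39 / 50 * a ≤ h → h ≤ 17 / 20 * a →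
    (∀ (a' h' : ℝ) (ha' : a' ≠ 0) (hh' : h' ≠ 0),
      (hcpPeriodicConfiguration ha hh).energyPerParticle lennardJones ≤
        (hcpPeriodicConfiguration ha' hh').energyPerParticle lennardJones) →
    |a - 97 / 100| ≤ 1 / 40 ∧ |h / Real.sqrt (2 / 3) - 97 / 100| ≤ 1 / 40 :=
  stub_pinFromSeries stub_hcpEnergySeries stub_pinNumerics

/-- **Truss propagation** (potential-free local-to-global rigidity of the hcp truss at one tolerance): for box
`(a,h)` and `δ, R, ε > 0` there are `θ > 0`, `R'` such that a particle of a `δ`-separated configuration all of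
whose fellows within `R'` are Good(4,θ) is Good(R,ε) (`stub_compactness` fed with `stub_exactLocalRules` fed
with `stub_keyRigidity`). [folklore] -/
theorem trussPropagation :
    ∀ (a h : ℝ) (ha : a ≠ 0) (hh : h ≠ 0), 47 / 50 ≤ a → a ≤ 1 → 39 / 50 * a ≤ h → h ≤ 17 / 20 * a →
    ∀ δ R ε : ℝ, 0 < δ → 0 < R → 0 < ε → ∃ θ : ℝ, 0 < θ ∧ ∃ R' : ℝ, 0 ≤ R' ∧
    ∀ (N : ℕ) (x : Fin N → EuclideanSpace ℝ (Fin 3)),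
      (∀ i j : Fin N, i ≠ j → δ ≤ dist (x i) (x j)) →
    let Good : ℝ → ℝ → Fin N → Prop := fun ρ η i =>
      ∃ A : EuclideanSpace ℝ (Fin 3) →ₗᵢ[ℝ] EuclideanSpace ℝ (Fin 3),
        (∀ p ∈ (hcpPeriodicConfiguration ha hh).points, ‖p‖ ≤ ρ →
          ∃ j : Fin N, dist (x j) (x i + A p) ≤ η) ∧
        (∀ j : Fin N, dist (x j) (x i) ≤ ρ →
          ∃ p ∈ (hcpPeriodicConfiguration ha hh).points, dist (x j) (x i + A p) ≤ η);
    ∀ i : Fin N, (∀ j : Fin N, dist (x j) (x i) ≤ R' → Good 4 θ j) → Good R ε i :=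
  fun a h ha hh ha₁ ha₂ hh₁ hh₂ =>
    stub_compactness a h ha hh ha₁ ha₂ hh₁ hh₂
      (stub_exactLocalRules a h ha hh ha₁ ha₂ hh₁ hh₂ (stub_keyRigidity a h ha hh ha₁ ha₂ hh₁ hh₂))

/-! ## Proved glue: clean-ball selection by double counting -/

/-- **Clean-ball selection (proved).** In a `δ`-separated configuration, if
`(2R'/δ + 1)³ · #{i : Bad i} < N` then some particle has no Bad particle within `R'`: otherwise every
particle is within `R'` of a Bad one, and a Bad particle has at most `(2R'/δ+1)³` particles within `R'`
(`card_le_of_separated_of_dist_le`, volumes of disjoint `δ/2`-balls). [folklore] -/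
theorem exists_clean_ball {N : ℕ} (x : Fin N → EuclideanSpace ℝ (Fin 3)) {δ R' : ℝ}
    (hδ : 0 < δ) (hR' : 0 ≤ R')
    (hsep : ∀ i j : Fin N, i ≠ j → δ ≤ dist (x i) (x j)) (Bad : Fin N → Prop)
    (hcount : (2 * R' / δ + 1) ^ 3 * (Nat.card {i : Fin N // Bad i} : ℝ) < N) :
    ∃ i : Fin N, ∀ j : Fin N, dist (x j) (x i) ≤ R' → ¬ Bad j := by
  classical
  by_contra hcon
  push Not at hcon
  choose f hf using hcon
  have hxinj : Function.Injective x := by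
    intro i j hij
    by_contra hne
    have h := hsep i j hne
    rw [hij, dist_self] at h
    exact absurd h (not_le.2 hδ)
  set B : Finset (Fin N) := Finset.univ.filter fun i => Bad i with hB
  have hcardB : (Nat.card {i : Fin N // Bad i} : ℝ) = B.card := by
    rw [Nat.card_eq_fintype_card, Fintype.card_subtype]
  have hfib : ∀ j : Fin N,
      ((Finset.univ.filter fun i => f i = j).card : ℝ) ≤ (2 * R' / δ + 1) ^ 3 := by
    intro j
    set F : Finset (Fin N) := Finset.univ.filter fun i => f i = j with hF
    have h1 : ((F.image x).card : ℝ) ≤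
        (2 * R' / δ + 1) ^ Module.finrank ℝ (EuclideanSpace ℝ (Fin 3)) := by
      refine card_le_of_separated_of_dist_le (F.image x) (x j) hδ hR' ?_ ?_
      · intro c hc
        obtain ⟨i, hi, rfl⟩ := Finset.mem_image.1 hc
        have hij : f i = j := (Finset.mem_filter.1 hi).2
        rw [← hij, dist_comm]
        exact (hf i).1
      · intro c hc d hd hcd
        obtain ⟨i, -, rfl⟩ := Finset.mem_image.1 hc
        obtain ⟨i', -, rfl⟩ := Finset.mem_image.1 hd
        exact hsep i i' fun h => hcd (congrArg x h)
    rw [Finset.card_image_of_injective _ hxinj, finrank_euclideanSpace_fin] at h1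
    exact h1
  have hcover : (Finset.univ : Finset (Fin N)) ⊆
      B.biUnion fun j => Finset.univ.filter fun i => f i = j := by
    intro i _
    refine Finset.mem_biUnion.2 ⟨f i, ?_, ?_⟩
    · exact Finset.mem_filter.2 ⟨Finset.mem_univ _, (hf i).2⟩
    · exact Finset.mem_filter.2 ⟨Finset.mem_univ _, rfl⟩
  have hN : (N : ℝ) ≤ (2 * R' / δ + 1) ^ 3 * (Nat.card {i : Fin N // Bad i} : ℝ) := by
    calc (N : ℝ) = ((Finset.univ : Finset (Fin N)).card : ℝ) := by simp
      _ ≤ ((B.biUnion fun j => Finset.univ.filter fun i => f i = j).card : ℝ) := by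
          exact_mod_cast Finset.card_le_card hcover
      _ ≤ ∑ j ∈ B, ((Finset.univ.filter fun i => f i = j).card : ℝ) := by
          exact_mod_cast Finset.card_biUnion_le
      _ ≤ ∑ j ∈ B, (2 * R' / δ + 1) ^ 3 := Finset.sum_le_sum fun j _ => hfib j
      _ = (2 * R' / δ + 1) ^ 3 * (Nat.card {i : Fin N // Bad i} : ℝ) := by
          rw [Finset.sum_const, nsmul_eq_mul, hcardB, mul_comm]
  exact absurd hcount (not_lt.2 hN)

/-! ## Proved glue: the floor and the trial bound compare hcp cells -/

/-- **Floor + trial blocks ⇒ lattice-sum comparison (proved; uses the LANDED `stub_trialBound`).** If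
`N·e(hcp a h) ≤ 𝓔(x)` for every finite injective `x` (the bulk floor of stmt-14477) then
`e(hcp a h) ≤ e(Q)` for every periodic `Q`: otherwise the trial bound `E(N) ≤ N·(e(Q) + η)` with
`η = (e(hcp a h) − e(Q))/2` and `N ≥ 1` contradicts `N·e(hcp a h) ≤ E(N)` (`le_ciInf` over the
non-empty type of injective configurations). [folklore] -/
theorem energyPerParticle_le_of_floor {a h : ℝ} (ha : a ≠ 0) (hh : h ≠ 0)
    (hfloor : ∀ (N : ℕ) (x : Fin N → EuclideanSpace ℝ (Fin 3)), Function.Injective x →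
      (N : ℝ) * (hcpPeriodicConfiguration ha hh).energyPerParticle lennardJones ≤
        interactionEnergy lennardJones x)
    (Q : PeriodicConfiguration 3) :
    (hcpPeriodicConfiguration ha hh).energyPerParticle lennardJones ≤
      Q.energyPerParticle lennardJones := by
  by_contra hlt
  push Not at hlt
  set e : ℝ := (hcpPeriodicConfiguration ha hh).energyPerParticle lennardJones with he
  set e' : ℝ := Q.energyPerParticle lennardJones with he'
  obtain ⟨N₀, hN₀⟩ := stub_trialBound Q ((e - e') / 2) (by linarith)
  set N : ℕ := max N₀ 1 with hN
  have htrial : groundStateEnergy lennardJones 3 N ≤ (N : ℝ) * (e' + (e - e') / 2) :=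
    hN₀ N (le_max_left _ _)
  have hne := nonempty_injective_config (d := 3) (by norm_num) N
  have hfl : (N : ℝ) * e ≤ groundStateEnergy lennardJones 3 N :=
    le_ciInf fun y => hfloor N y.1 y.2
  have hNpos : (0 : ℝ) < N := by
    have : 1 ≤ N := le_max_right _ _
    exact_mod_cast this
  nlinarith

/-! ## The composition -/

/-- **Composition (kernel-checked, sorry-free; the sibling cruxes
`HcpBulkFloor` (stmt-14477) and `HcpDefectCoercivity` (stmt-14476) are its two hypotheses BY NAME).**
`HcpBulkFloor → HcpDefectCoercivity → [windowPin, stub_trialBound (landed), trussPropagation,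
stub_isoDictionary] → CoarseGrains`: given `R`, take the floor point `(a,h)` (14477), compared
with every `hcp(a',h')` by the trial bound (`energyPerParticle_le_of_floor`) and pinned into the
window (`windowPin`), the proved minimal distance `δ` of LJ ground states, `(θ, R')` from truss
propagation at `(δ, R, 1/40)`, `κ(δ,θ)` from coercivity (14476) and `N₀` from the trial bound at
`η = κ/(2(2R'/δ+1)³)`; for a ground state with `N ≥ max N₀ 1` particles,
`κ·#Bad(4,θ) ≤ 𝓔(x) − N·e = E(N) − N·e ≤ N·η` gives `(2R'/δ+1)³·#Bad ≤ N/2 < N`, the clean ball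
(`exists_clean_ball`), a radius-`R` chart at tolerance `1/40` (`trussPropagation`) and the crux datum
(`stub_isoDictionary`). CONDITIONAL on the two named sibling cruxes. -/
theorem CoarseGrains_of (hFloor : HcpDefectCounting.HcpBulkFloor)
    (hCoer : HcpDefectCounting.HcpDefectCoercivity) : ExcessDecayLiouville.CoarseGrains := by
  classical
  dsimp only [ExcessDecayLiouville.CoarseGrains]
  intro R hR
  obtain ⟨a, h, ha, hh, ha₁, ha₂, hh₁, hh₂, hfloor⟩ := hFloor
  obtain ⟨hwa, hwh⟩ := windowPin a h ha hh ha₁ ha₂ hh₁ hh₂ fun a' h' ha' hh' =>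
    energyPerParticle_le_of_floor ha hh hfloor (hcpPeriodicConfiguration ha' hh')
  obtain ⟨δ, hδ, hsep⟩ := LennardJonesMinimalDistance_holds
  obtain ⟨θ, hθ, R', hR', hchart⟩ :=
    trussPropagation a h ha hh ha₁ ha₂ hh₁ hh₂ δ R (1 / 40) hδ hR (by norm_num)
  obtain ⟨κ, hκ, hcoer⟩ := hCoer a h ha hh ha₁ ha₂ hh₁ hh₂ hfloor δ θ hδ hθ
  set C : ℝ := (2 * R' / δ + 1) ^ 3 with hC
  have hCpos : 0 < C := by positivity
  obtain ⟨N₁, hN₁⟩ :=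
    stub_trialBound (hcpPeriodicConfiguration ha hh) (κ / (2 * C)) (by positivity)
  refine ⟨max N₁ 1, fun N hN x hx => ?_⟩
  have hN₁' : N₁ ≤ N := le_of_max_le_left hN
  have hNpos : (0 : ℝ) < N := by exact_mod_cast le_of_max_le_right hN
  have hxsep : ∀ i j : Fin N, i ≠ j → δ ≤ dist (x i) (x j) := hsep N x hx
  -- energy bookkeeping: κ·#Bad ≤ 𝓔(x) − N·e = E(N) − N·e ≤ N·κ/(2C)
  have hcoerx := hcoer N x hxsep
  dsimp only at hcoerx
  have hE : interactionEnergy lennardJones x = groundStateEnergy lennardJones 3 N := hx.2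
  have htrial := hN₁ N hN₁'
  rw [hE] at hcoerx
  set e : ℝ := (hcpPeriodicConfiguration ha hh).energyPerParticle lennardJones with he
  set bad : ℝ := (Nat.card {i : Fin N // ¬ ∃ A : EuclideanSpace ℝ (Fin 3) →ₗᵢ[ℝ]
      EuclideanSpace ℝ (Fin 3),
      (∀ p ∈ (hcpPeriodicConfiguration ha hh).points, ‖p‖ ≤ 4 →
        ∃ j : Fin N, dist (x j) (x i + A p) ≤ θ) ∧
      (∀ j : Fin N, dist (x j) (x i) ≤ 4 →
        ∃ p ∈ (hcpPeriodicConfiguration ha hh).points, dist (x j) (x i + A p) ≤ θ)} : ℝ)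
    with hbad
  have hbad0 : 0 ≤ bad := by positivity
  have hk : κ * bad ≤ (N : ℝ) * (κ / (2 * C)) := by linarith
  have hk2 : κ * (bad * (2 * C)) ≤ κ * N := by
    have h2C : (0 : ℝ) < 2 * C := by positivity
    have h1 : κ * bad ≤ (N : ℝ) * κ / (2 * C) := by simpa [mul_div_assoc] using hk
    have h3 := (le_div_iff₀ h2C).1 h1
    nlinarith [h3]
  have hk3 : bad * (2 * C) ≤ N := le_of_mul_le_mul_left hk2 hκ
  have hcount : C * bad < N := by nlinarith [hk3, hCpos, hNpos, hbad0]
  -- clean ball by counting Bad(4,θ) particles over balls centred at particles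
  obtain ⟨i, hi⟩ := exists_clean_ball x hδ hR' hxsep _ hcount
  -- truss propagation: the clean ball carries a radius-R chart at tolerance 1/40
  have hcharti := hchart N x hxsep
  dsimp only at hcharti
  have hgood := hcharti i fun j hj => not_not.1 (hi j hj)
  -- dictionary: the chart is a CoarseGrains datum
  have hD := stub_isoDictionary a h ha hh hwa hwh N x i R hgood
  dsimp only at hD
  exact hD

end Summit.AtomisticToContinuum.Crystallization.Theorems.ExcessDecayLiouvilleCoarseGrains

end
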